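import Summits.ResolutionOfSingularities.ResolutionOfSingularities.Theorems.PurelyInseparableDim4ScopeCover
import HarnessLib

/-!
# A `decide`-able BLINDNESS (out-of-coordinate-scope) certificate: monomial curves through the origin
# inside the `q`-fold locus (cell `res-dim4-pi`; scope column of the trap / cycle census ‖ K)

[OURS · counted 0 · instrument] Nothing here is a statement about resolution of singularities.
res-dim4-p-3's `…ScopeWitness` proves `¬ InCoordinateScope` from ONE ring map to a domain killing
`J_q⁺(F)` (`IsolationCert.not_inCoordinateScope_of_ringHom`); res-dim4-idea-2's `scopewit.py` certifies
OUT-of-scope for 466 / 945 census states by a MONOMIAL CURVE `xᵢ = cᵢ t^{wᵢ}` on which `J_q⁺(F)` vanishes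
while some Hasse derivative does not vanish at a point of the curve's coordinate hull.  This file makes
that certificate kernel-checkable by `decide` on presented states (`StepKit.SData`):

* `curveL c w L` evaluates a term list on the monomial curve (values in `Terms 1 K`, i.e. `K[t]` as
  `MvPolynomial (Fin 1) K`), `aeval_curve_evalT` is the transfer; `evalAtL a L` / `eval_evalT` evaluate at a
  point;
* **`blindB q s c w α₀ a`** checks: every `cᵢ ≠ 0` has `wᵢ ≥ 1` (curve through `0`); every Hasse
  derivative `D^{(α)}F`, `0 < |α| < q` (enumerated by `ScopeCover.idxLT`, computed by `ScopeCover.hasseL`)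
  vanishes on the curve; `aᵢ = 0` wherever `cᵢ = 0`; `0 < |α₀| < q` and `D^{(α₀)}F (a) ≠ 0`;
* **`not_inCoordinateScope_of_blindB`**: `blindB … = true → ¬ InCoordinateScope q s.toState.F`.
Acceptance: idea-2's SPECIMEN B state `x₁x₂³x₄ + x₁x₂³x₃³` (curve `(0, t, t, t³)`, `∂₁F(0,1,0,1) = 1`) by
`decide` (`blindB_specB`, `not_inCoordinateScope_specB`).  Rational (graph-type) components such as
T-002's `x₄(1+x₂) + εx₂` are NOT reached by monomial curves (see `…UniformTrapScope` for those).
OURS; counted 0.  bears_on: LADDER-RESOLUTION:D157-DOOR2 (res-dim4-pi · frame v4 scope column).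
Supports stmt-ResolutionOfSingularities-16155 (helper).
-/

set_option linter.dupNamespace false -- mandated namespace of this single-conjunct summit

noncomputable section

open MvPolynomial Finset

namespace Summit.ResolutionOfSingularities.ResolutionOfSingularities.Theorems.PIDim4

namespace ScopeBlind

open StepKit ScopeCover
open Literature.AlgebraicGeometry.Resolution

variable {K : Type} [Field K]

/-! ## §1 Evaluation of term lists on a monomial curve and at a point -/

/-- The monomial curve `t ↦ (cᵢ t^{wᵢ})ᵢ` as an algebra map into `K[t] = MvPolynomial (Fin 1) K`. [folklore] -/
def curveHom (c : Fin 4 → K) (w : Fin 4 → ℕ) : MvPolynomial (Fin 4) K →ₐ[K] MvPolynomial (Fin 1) K :=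
  MvPolynomial.aeval fun i => monomial (Finsupp.single 0 (w i)) (c i)

/-- Term-list image of the curve substitution: `c·x^e ↦ (c ∏ cᵢ^{eᵢ}) · t^{Σ eᵢwᵢ}`. [folklore] -/
def curveL (c : Fin 4 → K) (w : Fin 4 → ℕ) (L : Terms 4 K) : Terms 1 K :=
  L.map fun t => (fun _ => ∑ i, t.1 i * w i, t.2 * ∏ i, c i ^ t.1 i)

/-- The curve map on a monomial. -/
theorem curveHom_monomial (c : Fin 4 → K) (w : Fin 4 → ℕ) (e : Fin 4 → ℕ) (a : K) :
    curveHom c w (monomial (expo e) a) = monomial (expo fun _ : Fin 1 => ∑ i, e i * w i) (a * ∏ i, c i ^ e i) := by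
  rw [curveHom, monomial_expo_eq, monomial_expo_eq, map_mul, MvPolynomial.algHom_C, MvPolynomial.algebraMap_eq,
    map_prod]
  simp only [map_pow, MvPolynomial.aeval_X, Fin.prod_univ_four, Fin.sum_univ_four, Fin.prod_univ_one,
    ← C_mul_X_pow_eq_monomial, map_mul, map_pow]
  ring

/-- **Transfer**: the curve map on a presented polynomial. [folklore] -/
theorem aeval_curve_evalT (c : Fin 4 → K) (w : Fin 4 → ℕ) (L : Terms 4 K) :
    curveHom c w (evalT L) = evalT (curveL c w L) := by
  induction L with
  | nil => simp [curveL]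
  | cons t L ih =>
    simp only [curveL, List.map_cons, evalT_cons] at ih ⊢
    rw [map_add, ih, curveHom_monomial]

/-- Evaluation of a term list at a point. [folklore] -/
def evalAtL (a : Fin 4 → K) (L : Terms 4 K) : K := (L.map fun t => t.2 * ∏ i, a i ^ t.1 i).sum

/-- **Transfer**: evaluation at a point. [folklore] -/
theorem eval_evalT (a : Fin 4 → K) (L : Terms 4 K) : MvPolynomial.eval a (evalT L) = evalAtL a L := by
  induction L with
  | nil => simp [evalAtL]
  | cons t L ih =>
    simp only [evalAtL, List.map_cons, List.sum_cons, evalT_cons] at ih ⊢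
    rw [map_add, ih, monomial_expo_eq, map_mul, eval_C, map_prod]
    simp only [map_pow, eval_X]

/-- The curve passes through the origin when every non-zero `cᵢ` has `wᵢ ≥ 1`: then `ker ≤ 𝔪₀`. [folklore] -/
theorem eval_zero_of_curveHom_eq_zero {c : Fin 4 → K} {w : Fin 4 → ℕ} (hw : ∀ i, c i = 0 ∨ 1 ≤ w i)
    (g : MvPolynomial (Fin 4) K) (hg : (curveHom c w).toRingHom g = 0) :
    MvPolynomial.eval (0 : Fin 4 → K) g = 0 := by
  have hcomp : (MvPolynomial.eval (0 : Fin 1 → K)).comp (curveHom c w).toRingHom =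
      MvPolynomial.eval (0 : Fin 4 → K) := by
    refine MvPolynomial.ringHom_ext (fun r => ?_) (fun i => ?_)
    · simp [curveHom]
    · simp only [RingHom.comp_apply, AlgHom.toRingHom_eq_coe, AlgHom.coe_toRingHom, curveHom,
        MvPolynomial.aeval_X, eval_monomial, Pi.zero_apply, eval_X]
      rcases hw i with h | h
      · rw [h, zero_mul]
      · rw [Finsupp.prod_single_index (by simp), zero_pow (by omega), mul_zero]
  rw [← hcomp, RingHom.comp_apply, hg, map_zero]

/-! ## §2 The certificate -/

variable [DecidableEq K]

/-- **Blindness check**: curve through `0`, every `D^{(α)}F` (`0 < |α| < q`) vanishes on the curve,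
`a` lies in the coordinate hull `(xᵢ : cᵢ = 0)` of the curve, and `D^{(α₀)}F(a) ≠ 0` with `0 < |α₀| < q`.
[folklore] -/
def blindB (q : ℕ) (s : SData 4 K) (c : Fin 4 → K) (w : Fin 4 → ℕ) (α₀ : Fin 4 → ℕ) (a : Fin 4 → K) : Bool :=
  decide (∀ i, c i = 0 ∨ 1 ≤ w i) &&
    ((idxLT q).all fun α => StepKit.equivB (curveL c w (hasseL α s.L)) []) &&
    decide (∀ i, c i = 0 → a i = 0) &&
    decide (0 < ∑ i, α₀ i ∧ ∑ i, α₀ i < q) &&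
    !decide (evalAtL a (hasseL α₀ s.L) = 0)

/-- **Soundness of the blindness check** (via res-dim4-p-3's kernel-form certificate). [folklore] -/
theorem not_inCoordinateScope_of_blindB {q : ℕ} {s : SData 4 K} {c : Fin 4 → K} {w : Fin 4 → ℕ}
    {α₀ : Fin 4 → ℕ} {a : Fin 4 → K} (h : blindB q s c w α₀ a = true) : ¬ InCoordinateScope q s.toState.F := by
  simp only [blindB, Bool.and_eq_true, decide_eq_true_eq, List.all_eq_true, Bool.not_eq_true',
    decide_eq_false_iff_not] at h
  obtain ⟨⟨⟨⟨hw, hJ⟩, ha⟩, hα₀⟩, hne⟩ := h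
  have hdeg : (expo α₀).degree = ∑ i, α₀ i := degree_expo α₀
  refine IsolationCert.not_inCoordinateScope_of_ringHom (curveHom c w).toRingHom (fun α h0 hq => ?_)
    (eval_zero_of_curveHom_eq_zero hw) (Finset.univ.filter fun i => c i = 0) (fun i hi => ?_)
    (expo α₀) (by rw [hdeg]; exact hα₀.1) (by rw [hdeg]; exact hα₀.2) a (fun i hi => ?_) ?_
  · change curveHom c w (hasseDeriv α s.toState.F) = 0
    rw [SData.toState_F, ← expo_coe α, hasseDeriv_evalT, aeval_curve_evalT,
      evalT_eq_zero_iff]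
    exact hJ (⇑α) (mem_idxLT h0 hq)
  · change curveHom c w (X i) ≠ 0
    have hci : c i ≠ 0 := by simpa using hi
    rw [curveHom, MvPolynomial.aeval_X]
    exact (monomial_eq_zero).not.mpr hci
  · exact ha i (by simpa using hi)
  · rw [SData.toState_F, hasseDeriv_evalT, eval_evalT]
    exact hne

/-! ## §3 Acceptance: idea-2's SPECIMEN B state is blind (`p = q = 2`) -/

/-- SPECIMEN B's recurring state `x₁x₂³x₄ + x₁x₂³x₃³` (idea-2 16:37:07Z: OUT of scope via the curve
`x₁ = 0`, `(x₂,x₃,x₄) = (t,t,t³)`). [folklore] -/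
def specB : SData 4 (ZMod 2) := ⟨[(![1, 3, 0, 1], 1), (![1, 3, 3, 0], 1)], ![0, 0, 0, 0], {0}⟩

/-- The blindness check passes: curve `c = (0,1,1,1)`, `w = (0,1,1,3)`, `α₀ = e₁`, `a = (0,1,0,1)`. -/
theorem blindB_specB : blindB 2 specB ![0, 1, 1, 1] ![0, 1, 1, 3] ![1, 0, 0, 0] ![0, 1, 0, 1] = true := by
  decide

/-- **SPECIMEN B is OUT of coordinate scope** (kernel). [folklore] -/
theorem not_inCoordinateScope_specB : ¬ InCoordinateScope 2 specB.toState.F :=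
  not_inCoordinateScope_of_blindB blindB_specB

end ScopeBlind

end Summit.ResolutionOfSingularities.ResolutionOfSingularities.Theorems.PIDim4

end
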